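import Summits.Ventures.PercRepro.SixThreeCounts

/-!
# PercRepro — the (6,3) additive one-long-line table, part A: definitions and the kernel-checked table (p3, gen 7 / gen 9 split)

mine-2's `MINE2-RLS.md` §19.7 Steps 3–4 (θ = 6; tools `planar_additive.py`, data `planar_additive-th6-g40.out`): for a
plane `G` on `g` points with line profile `{m_ℓ}` (sizes of the lines with ≥ 3 points) the profile function

    Δ_t(g, {m_ℓ}) := F_t(g, {m_ℓ}) − D_t(g, {m_ℓ})

is ADDITIVE over the lines, `Δ_t = A_t(g) + Σ_ℓ B_t(g, m_ℓ)`, and the one-long-line bound makes the finite part `g ≤ 40`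
a table of exact rationals.  This file defines `F`, `D`, `Δ`, `A`, `B` exactly as in `planar_additive.py` (every quantity a
closed form in `g`, the profile and the per-type values `v_t(type, s)` at θ = 6), proves the additivity identity, and
checks the table by `decide +kernel` (no `native_decide`; 9 chunks for `g ≤ 31`, one theorem per `(t, g)` for `g = 32..40` —
the 9-row chunks there hit the kernel budget on some farm nodes, lead ruling 2026-08-22T20:16:58Z).  The matroid side (the counts of an actual plane through its
line profile, `card_rank_three_subsets_add`, `card_line_plus_subsets`, `Lam_le`, …) is p2's `SixThreeCounts` / `SixThreeLam`;
this file is the pure table; the bridge from the Boolean table to the inequalities `table_general_short` /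
`table_general_long` / `table_linePoint` / `table_twoLines_meet` / `table_twoLines_disj` is part B (`SixThreeTable.lean`).

Conventions (planar_additive.py): for a set of size `b` with `Λ` the shares are
`w₁ = 6^{b−3}/(6^{b−3}+Λ)`, `w₂ = 6^{b−3}/(6^{b−3}+2Λ+b)`, `w₂⁻ = 6^{b−3}/(6^{b−3}+6Λ+b)`;
`v_t = n·w₁ + (C(n,2) − π_t)·w₂ + π_t·w₂⁻` with `n = 6 − t`, `(π₁,π₂,π₃) = (3,1,0)`;
types: triple `(1/4, 1/10, 1/15)`; 4-generic `Λ = 6`; 4-collinear (3-line + point) `Λ = 9`;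
`s ≥ 5`: line+point `Λ = 6^{s−3} + s − 1`; `(s−2)`-type (and every non-lp 5-set) `Λ = 6^{s−4} + 2s`;
rest (`s ≥ 6`) `Λ = 6^{s−5}·C(s,2)/C(s−3,2)`.
-/

namespace PercRepro.SixThree.Table

/-- Binomial coefficient through factorials: kernel-friendly (`Nat.choose` unfolds Pascal's rule exponentially). -/
def ch (n k : ℕ) : ℕ := if k ≤ n then n.factorial / (k.factorial * (n - k).factorial) else 0

/-- `ch` is `Nat.choose`. -/
theorem ch_eq_choose (n k : ℕ) : ch n k = n.choose k := by
  unfold ch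
  split_ifs with h
  · exact (Nat.choose_eq_factorial_div_factorial h).symm
  · exact (Nat.choose_eq_zero_of_lt (not_le.1 h)).symm

/-- `Σ_{i = lo}^{hi} f i` by structural recursion on `hi` (kernel-friendly). -/
def sumIcc (f : ℕ → ℚ) (lo : ℕ) : ℕ → ℚ
  | 0 => if lo = 0 then f 0 else 0
  | n + 1 => sumIcc f lo n + (if lo ≤ n + 1 then f (n + 1) else 0)

/-- shares of a `b`-set with `Λ` (θ = 6): `(w₁, w₂, w₂⁻)`. -/
def w1 (b : ℕ) (Λ : ℚ) : ℚ := (6 : ℚ) ^ (b - 3) / ((6 : ℚ) ^ (b - 3) + Λ)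
/-- `w₂`: the generic-pair share. -/
def w2 (b : ℕ) (Λ : ℚ) : ℚ := (6 : ℚ) ^ (b - 3) / ((6 : ℚ) ^ (b - 3) + 2 * Λ + b)
/-- `w₂⁻`: the parallel-pair share lower bound. -/
def w2m (b : ℕ) (Λ : ℚ) : ℚ := (6 : ℚ) ^ (b - 3) / ((6 : ℚ) ^ (b - 3) + 6 * Λ + b)

/-- `π_t`: the number of parallel pairs of `N = M/G` at type `t` (3, 1, 0). -/
def πt : ℕ → ℕ
  | 1 => 3
  | 2 => 1
  | _ => 0

/-- `v_t` from the three shares: `n·w₁ + (C(n,2) − π_t)·w₂ + π_t·w₂⁻`, `n = 6 − t`. -/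
def v (t : ℕ) (a b c : ℚ) : ℚ :=
  ((6 - t : ℕ) : ℚ) * a + (((ch (6 - t) 2 - πt t : ℕ) : ℚ)) * b + (πt t : ℚ) * c

/-- `v_t` of an independent triple (`w₁, w₂, w₂⁻ = 1/4, 1/10, 1/15`). -/
def vTriple (t : ℕ) : ℚ := v t (1/4) (1/10) (1/15)
/-- `v_t` of a generic 4-set (`Λ = 6`). -/
def vGen4 (t : ℕ) : ℚ := v t (w1 4 6) (w2 4 6) (w2m 4 6)
/-- `v_t` of a 3-line + point 4-set (`Λ = θ + 3 = 9`). -/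
def vCol4 (t : ℕ) : ℚ := v t (w1 4 9) (w2 4 9) (w2m 4 9)
/-- `Λ` of a line + point `s`-set: `6^{s−3} + s − 1`. -/
def ΛLp (s : ℕ) : ℚ := (6 : ℚ) ^ (s - 3) + ((s - 1 : ℕ) : ℚ)
/-- the maximal `Λ` of an `(s−2)`-type `s`-set: `6^{s−4} + 2s` (= `6^{s−4} + θ + 2s − 6` at `θ = 6`). -/
def ΛNon (s : ℕ) : ℚ := (6 : ℚ) ^ (s - 4) + 2 * (s : ℚ)
/-- the density bound on `Λ` for the rest type: `6^{s−5}·C(s,2)/C(s−3,2)`. -/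
def ΛRest (s : ℕ) : ℚ := (6 : ℚ) ^ (s - 5) * (ch s 2 : ℚ) / (ch (s - 3) 2 : ℚ)
/-- `v_t(lp, s)`. -/
def vLp (t s : ℕ) : ℚ := v t (w1 s (ΛLp s)) (w2 s (ΛLp s)) (w2m s (ΛLp s))
/-- `v_t((s−2)-type, s)`. -/
def vNon (t s : ℕ) : ℚ := v t (w1 s (ΛNon s)) (w2 s (ΛNon s)) (w2m s (ΛNon s))
/-- `v_t(rest, s)`. -/
def vRest (t s : ℕ) : ℚ := v t (w1 s (ΛRest s)) (w2 s (ΛRest s)) (w2m s (ΛRest s))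

/-! ## Profile counts (profile = list of line sizes `m ≥ 3`; the 2-point lines are implicit) -/

/-- `T` = independent triples. -/
def Tcnt (g : ℕ) (prof : List ℕ) : ℚ := (ch g 3 : ℚ) - (prof.map fun m => (ch m 3 : ℚ)).sum
/-- `N₃` = rank-3 subsets of any size. -/
def N3cnt (g : ℕ) (prof : List ℕ) : ℚ :=
  sumIcc (fun s => (ch g s : ℚ)) 3 g - (prof.map fun (m : ℕ) => ((2 : ℚ) ^ m - 1 - (m : ℚ) - (ch m 2 : ℚ))).sum
/-- `N₄^c` = 3-line + point 4-sets. -/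
def N4c (g : ℕ) (prof : List ℕ) : ℚ := (prof.map fun m => (ch m 3 : ℚ) * ((g - m : ℕ) : ℚ)).sum
/-- `N₄^g` = generic 4-sets: `(T(g−3) − 3N₄^c)/4`. -/
def N4g (g : ℕ) (prof : List ℕ) : ℚ := (Tcnt g prof * ((g - 3 : ℕ) : ℚ) - 3 * N4c g prof) / 4
/-- `N_s` = rank-3 `s`-subsets. -/
def Ns (g : ℕ) (prof : List ℕ) (s : ℕ) : ℚ := (ch g s : ℚ) - (prof.map fun m => (ch m s : ℚ)).sum
/-- `lp_s` = line + point `s`-sets. -/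
def lps (g : ℕ) (prof : List ℕ) (s : ℕ) : ℚ := (prof.map fun m => ((g - m : ℕ) : ℚ) * ch m (s - 1)).sum
/-- `d_s` = `(s−2)`-type `s`-sets (`s ≥ 6`); for `s = 5` every non-lp set counts here. -/
def ds (g : ℕ) (prof : List ℕ) (s : ℕ) : ℚ :=
  if 6 ≤ s then (prof.map fun m => (ch m (s - 2) : ℚ) * ch (g - m) 2).sum else Ns g prof s - lps g prof s
/-- `rest_s`. -/
def rests (g : ℕ) (prof : List ℕ) (s : ℕ) : ℚ := Ns g prof s - lps g prof s - ds g prof s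

/-- `F_t(g, prof)`: the profile lower bound of the supply side. -/
def F (t g : ℕ) (prof : List ℕ) : ℚ :=
  Tcnt g prof * vTriple t + N4g g prof * vGen4 t + N4c g prof * vCol4 t +
    sumIcc (fun s => lps g prof s * vLp t s + ds g prof s * vNon t s + rests g prof s * vRest t s) 5 g

/-- `C₂` (general planes): `1 + g + Σ_ℓ (2^m − m − 1) + (C(g,2) − Σ_ℓ C(m,2))`. -/
def C2 (g : ℕ) (prof : List ℕ) : ℚ :=
  1 + (g : ℚ) + (prof.map fun (m : ℕ) => ((2 : ℚ) ^ m - (m : ℚ) - 1)).sum + ((ch g 2 : ℚ) - (prof.map fun (m : ℕ) => (ch m 2 : ℚ)).sum)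

/-- `D_t(g, prof)`: the demand (general planes). -/
def D (t g : ℕ) (prof : List ℕ) : ℚ :=
  match t with
  | 1 => 3 * (N3cnt g prof - 1)
  | 2 => 3 * (N3cnt g prof - 1 - g)
  | _ => 3 * (N3cnt g prof - C2 g prof)

/-- `Δ_t(g, prof) := F_t − D_t`. -/
def Δ (t g : ℕ) (prof : List ℕ) : ℚ := F t g prof - D t g prof
/-- `A_t(g) := Δ_t(U_{3,g})` (no line with ≥ 3 points). -/
def A (t g : ℕ) : ℚ := Δ t g []
/-- `B_t(g, m) := Δ_t({m}) − A_t(g)`, the contribution of one `m`-point line. -/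
def B (t g m : ℕ) : ℚ := Δ t g [m] - A t g

/-! ## Additivity over the lines (Step 3): `Δ_t(g, prof) = A_t(g) + Σ_ℓ B_t(g, m_ℓ)` -/

/-- `sumIcc` is additive in the summand. -/
theorem sumIcc_add (f g : ℕ → ℚ) (lo n : ℕ) :
    sumIcc (fun s => f s + g s) lo n = sumIcc f lo n + sumIcc g lo n := by
  induction n with
  | zero => simp only [sumIcc]; split_ifs <;> simp
  | succ n ih => simp only [sumIcc, ih]; split_ifs <;> ring

/-- `sumIcc` respects subtraction of summands. -/
theorem sumIcc_sub (f g : ℕ → ℚ) (lo n : ℕ) :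
    sumIcc (fun s => f s - g s) lo n = sumIcc f lo n - sumIcc g lo n := by
  induction n with
  | zero => simp only [sumIcc]; split_ifs <;> simp
  | succ n ih => simp only [sumIcc, ih]; split_ifs <;> ring

/-- `sumIcc` only depends on the summand's values. -/
theorem sumIcc_congr {f g : ℕ → ℚ} (h : ∀ s, f s = g s) (lo n : ℕ) : sumIcc f lo n = sumIcc g lo n := by
  induction n with
  | zero => simp only [sumIcc, h]
  | succ n ih => simp only [sumIcc, ih, h]

/-- the per-`s` summand of `F`. -/
def summand (t g : ℕ) (prof : List ℕ) (s : ℕ) : ℚ :=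
  lps g prof s * vLp t s + ds g prof s * vNon t s + rests g prof s * vRest t s

/-- the summand is additive under `cons` (each count is a constant plus a sum over the lines). -/
theorem summand_cons (t g m : ℕ) (prof : List ℕ) (s : ℕ) :
    summand t g (m :: prof) s = summand t g prof s + (summand t g [m] s - summand t g [] s) := by
  simp only [summand, lps, ds, rests, Ns, List.map_cons, List.sum_cons, List.map_nil, List.sum_nil]
  split_ifs <;> ring

/-- `F` is additive under `cons`. -/
theorem F_cons (t g m : ℕ) (prof : List ℕ) :
    F t g (m :: prof) = F t g prof + (F t g [m] - F t g []) := by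
  have hS : sumIcc (summand t g (m :: prof)) 5 g =
      sumIcc (summand t g prof) 5 g + (sumIcc (summand t g [m]) 5 g - sumIcc (summand t g []) 5 g) := by
    rw [← sumIcc_sub, ← sumIcc_add]
    exact sumIcc_congr (summand_cons t g m prof) 5 g
  have e : ∀ p : List ℕ, F t g p = Tcnt g p * vTriple t + N4g g p * vGen4 t + N4c g p * vCol4 t +
      sumIcc (summand t g p) 5 g := fun p => rfl
  rw [e, e, e, e, hS]
  simp only [Tcnt, N4g, N4c, List.map_cons, List.sum_cons, List.map_nil, List.sum_nil]
  ring

/-- `D` is additive under `cons`. -/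
theorem D_cons (t g m : ℕ) (prof : List ℕ) :
    D t g (m :: prof) = D t g prof + (D t g [m] - D t g []) := by
  unfold D
  split <;> simp only [N3cnt, C2, List.map_cons, List.sum_cons, List.map_nil, List.sum_nil] <;> ring

/-- `Δ` is additive under `cons`: the contribution of a line of size `m` is `B_t(g, m)`. -/
theorem Δ_cons (t g m : ℕ) (prof : List ℕ) : Δ t g (m :: prof) = Δ t g prof + B t g m := by
  simp only [Δ, B, A, F_cons t g m prof, D_cons t g m prof]; ring

/-- **Additivity (§19.7 Step 3)**: `Δ_t(g, prof) = A_t(g) + Σ_{m ∈ prof} B_t(g, m)`. -/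
theorem Δ_additive (t g : ℕ) (prof : List ℕ) : Δ t g prof = A t g + (prof.map (B t g)).sum := by
  induction prof with
  | nil => simp [A]
  | cons m l ih => rw [Δ_cons, ih]; simp only [List.map_cons, List.sum_cons]; ring

/-! ## The one-long-line bound (Step 4) as a Boolean check -/

/-- `ρ_t(g) := min(0, min_{3 ≤ m ≤ h} B_t(g,m)/C(m,2))`, `h = ⌊(g+1)/2⌋`. -/
def ρ (t g : ℕ) : ℚ :=
  (((List.range ((g + 1) / 2 + 1)).filter fun m => 3 ≤ m).map fun m => B t g m / (ch m 2 : ℚ)).foldl min 0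

/-- general planes: `A + C(g,2)ρ ≥ 0` and, for every candidate long line `h < m ≤ g − 3`, `A + B(m) + (C(g,2) − C(m,2))ρ ≥ 0`. -/
def generalOK (t g : ℕ) : Bool :=
  decide (0 ≤ A t g + (ch g 2 : ℚ) * ρ t g) &&
    (List.range g).all fun m =>
      if (g + 1) / 2 < m ∧ m + 3 ≤ g then decide (0 ≤ A t g + B t g m + ((ch g 2 : ℚ) - ch m 2) * ρ t g) else true

/-- line + point (`m = g − 1`): `A + B(g−1) − 3[t = 2] ≥ 0`. -/
def linePointOK (t g : ℕ) : Bool :=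
  decide (0 ≤ A t g + B t g (g - 1) - (if t = 2 then 3 else 0))

/-- two lines meeting (`g = m₁ + m₂ − 1`, `m₂ ≥ 3`): `A + B(m₁) + B(m₂) − 12[t = 3] ≥ 0`;
    two disjoint lines (`g = m₁ + m₂`, `m₂ ≥ 2`, `B(2) := 0`): `A + B(m₁) + B(m₂) − 6[t = 3] ≥ 0`. -/
def twoLinesOK (t g : ℕ) : Bool :=
  (List.range g).all fun m1 => (List.range (m1 + 1)).all fun m2 =>
    (if 3 ≤ m2 ∧ m1 + m2 = g + 1 then decide (0 ≤ A t g + B t g m1 + B t g m2 - (if t = 3 then 12 else 0)) else true) &&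
    (if 2 ≤ m2 ∧ m1 + m2 = g then decide (0 ≤ A t g + B t g m1 + (if 3 ≤ m2 then B t g m2 else 0) - (if t = 3 then 6 else 0)) else true)

/-- the whole Step-4 check for one `(t, g)`. -/
def tableOK (t g : ℕ) : Bool := generalOK t g && linePointOK t g && twoLinesOK t g

end PercRepro.SixThree.Table

set_option Elab.async false

namespace PercRepro.SixThree.Table

/-- chunk `k ∈ {0,1,2}` of the range: `tableOK t g` for `g = 9k + 5 .. 9k + 13` (`g ≤ 31`; the rows `g ≥ 32` are one
theorem each below — a 9-row chunk there exceeds the kernel budget of `decide +kernel` on some farm nodes). -/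
def chunkOK (t k : ℕ) : Bool := (List.range 9).all fun i => tableOK t (9 * k + i + 5)

/-! ## The table, kernel-checked in 9 chunks (`g ≤ 31`) and 27 single rows (`g = 32..40`) — no `native_decide` -/

/-- `t = 1`, `g = 5..13`. -/
theorem chunkOK_1_0 : chunkOK 1 0 = true := by decide +kernel
/-- `t = 1`, `g = 14..22`. -/
theorem chunkOK_1_1 : chunkOK 1 1 = true := by decide +kernel
/-- `t = 1`, `g = 23..31`. -/
theorem chunkOK_1_2 : chunkOK 1 2 = true := by decide +kernel
/-- `t = 2`, `g = 5..13`. -/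
theorem chunkOK_2_0 : chunkOK 2 0 = true := by decide +kernel
/-- `t = 2`, `g = 14..22`. -/
theorem chunkOK_2_1 : chunkOK 2 1 = true := by decide +kernel
/-- `t = 2`, `g = 23..31`. -/
theorem chunkOK_2_2 : chunkOK 2 2 = true := by decide +kernel
/-- `t = 3`, `g = 5..13`. -/
theorem chunkOK_3_0 : chunkOK 3 0 = true := by decide +kernel
/-- `t = 3`, `g = 14..22`. -/
theorem chunkOK_3_1 : chunkOK 3 1 = true := by decide +kernel
/-- `t = 3`, `g = 23..31`. -/
theorem chunkOK_3_2 : chunkOK 3 2 = true := by decide +kernel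

/-- `t = 1`, `g = 32`. -/
theorem tableOK_1_32 : tableOK 1 32 = true := by decide +kernel
/-- `t = 1`, `g = 33`. -/
theorem tableOK_1_33 : tableOK 1 33 = true := by decide +kernel
/-- `t = 1`, `g = 34`. -/
theorem tableOK_1_34 : tableOK 1 34 = true := by decide +kernel
/-- `t = 1`, `g = 35`. -/
theorem tableOK_1_35 : tableOK 1 35 = true := by decide +kernel
/-- `t = 1`, `g = 36`. -/
theorem tableOK_1_36 : tableOK 1 36 = true := by decide +kernel
/-- `t = 1`, `g = 37`. -/
theorem tableOK_1_37 : tableOK 1 37 = true := by decide +kernel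
/-- `t = 1`, `g = 38`. -/
theorem tableOK_1_38 : tableOK 1 38 = true := by decide +kernel
/-- `t = 1`, `g = 39`. -/
theorem tableOK_1_39 : tableOK 1 39 = true := by decide +kernel
/-- `t = 1`, `g = 40`. -/
theorem tableOK_1_40 : tableOK 1 40 = true := by decide +kernel
/-- `t = 2`, `g = 32`. -/
theorem tableOK_2_32 : tableOK 2 32 = true := by decide +kernel
/-- `t = 2`, `g = 33`. -/
theorem tableOK_2_33 : tableOK 2 33 = true := by decide +kernel
/-- `t = 2`, `g = 34`. -/
theorem tableOK_2_34 : tableOK 2 34 = true := by decide +kernel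
/-- `t = 2`, `g = 35`. -/
theorem tableOK_2_35 : tableOK 2 35 = true := by decide +kernel
/-- `t = 2`, `g = 36`. -/
theorem tableOK_2_36 : tableOK 2 36 = true := by decide +kernel
/-- `t = 2`, `g = 37`. -/
theorem tableOK_2_37 : tableOK 2 37 = true := by decide +kernel
/-- `t = 2`, `g = 38`. -/
theorem tableOK_2_38 : tableOK 2 38 = true := by decide +kernel
/-- `t = 2`, `g = 39`. -/
theorem tableOK_2_39 : tableOK 2 39 = true := by decide +kernel
/-- `t = 2`, `g = 40`. -/
theorem tableOK_2_40 : tableOK 2 40 = true := by decide +kernel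
/-- `t = 3`, `g = 32`. -/
theorem tableOK_3_32 : tableOK 3 32 = true := by decide +kernel
/-- `t = 3`, `g = 33`. -/
theorem tableOK_3_33 : tableOK 3 33 = true := by decide +kernel
/-- `t = 3`, `g = 34`. -/
theorem tableOK_3_34 : tableOK 3 34 = true := by decide +kernel
/-- `t = 3`, `g = 35`. -/
theorem tableOK_3_35 : tableOK 3 35 = true := by decide +kernel
/-- `t = 3`, `g = 36`. -/
theorem tableOK_3_36 : tableOK 3 36 = true := by decide +kernel
/-- `t = 3`, `g = 37`. -/
theorem tableOK_3_37 : tableOK 3 37 = true := by decide +kernel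
/-- `t = 3`, `g = 38`. -/
theorem tableOK_3_38 : tableOK 3 38 = true := by decide +kernel
/-- `t = 3`, `g = 39`. -/
theorem tableOK_3_39 : tableOK 3 39 = true := by decide +kernel
/-- `t = 3`, `g = 40`. -/
theorem tableOK_3_40 : tableOK 3 40 = true := by decide +kernel

/-- `t = 1`, `g = 4` (the profiles `[]` and `[3]`). -/
theorem tableOK_1_4 : tableOK 1 4 = true := by decide +kernel
/-- `t = 2`, `g = 4`. -/
theorem tableOK_2_4 : tableOK 2 4 = true := by decide +kernel
/-- `t = 3`, `g = 4`. -/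
theorem tableOK_3_4 : tableOK 3 4 = true := by decide +kernel

/-- every chunk, `t ∈ {1,2,3}`, `k ≤ 2`. -/
theorem chunkOK_of {t k : ℕ} (ht : t = 1 ∨ t = 2 ∨ t = 3) (hk : k ≤ 2) : chunkOK t k = true := by
  rcases ht with rfl | rfl | rfl <;> interval_cases k
  · exact chunkOK_1_0
  · exact chunkOK_1_1
  · exact chunkOK_1_2
  · exact chunkOK_2_0
  · exact chunkOK_2_1
  · exact chunkOK_2_2
  · exact chunkOK_3_0
  · exact chunkOK_3_1
  · exact chunkOK_3_2

/-- every single row `g = 32..40`, `t ∈ {1,2,3}`. -/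
theorem tableOK_of_large {t g : ℕ} (ht : t = 1 ∨ t = 2 ∨ t = 3) (hg32 : 32 ≤ g) (hg40 : g ≤ 40) :
    tableOK t g = true := by
  rcases ht with rfl | rfl | rfl <;> interval_cases g
  · exact tableOK_1_32
  · exact tableOK_1_33
  · exact tableOK_1_34
  · exact tableOK_1_35
  · exact tableOK_1_36
  · exact tableOK_1_37
  · exact tableOK_1_38
  · exact tableOK_1_39
  · exact tableOK_1_40
  · exact tableOK_2_32
  · exact tableOK_2_33
  · exact tableOK_2_34
  · exact tableOK_2_35
  · exact tableOK_2_36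
  · exact tableOK_2_37
  · exact tableOK_2_38
  · exact tableOK_2_39
  · exact tableOK_2_40
  · exact tableOK_3_32
  · exact tableOK_3_33
  · exact tableOK_3_34
  · exact tableOK_3_35
  · exact tableOK_3_36
  · exact tableOK_3_37
  · exact tableOK_3_38
  · exact tableOK_3_39
  · exact tableOK_3_40

/-- `tableOK t g` for every `t ∈ {1,2,3}` and `4 ≤ g ≤ 40`. -/
theorem tableOK_of {t g : ℕ} (ht : t = 1 ∨ t = 2 ∨ t = 3) (hg4 : 4 ≤ g) (hg40 : g ≤ 40) :
    tableOK t g = true := by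
  rcases Nat.eq_or_lt_of_le hg4 with h4 | hg5
  · subst h4
    rcases ht with rfl | rfl | rfl
    · exact tableOK_1_4
    · exact tableOK_2_4
    · exact tableOK_3_4
  by_cases h32 : 32 ≤ g
  · exact tableOK_of_large ht h32 hg40
  have key : chunkOK t ((g - 5) / 9) = true := chunkOK_of ht (by omega)
  unfold chunkOK at key
  rw [List.all_eq_true] at key
  have h := key ((g - 5) % 9) (List.mem_range.2 (Nat.mod_lt _ (by norm_num)))
  have e : 9 * ((g - 5) / 9) + (g - 5) % 9 + 5 = g := by omega
  rwa [e] at h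

end PercRepro.SixThree.Table
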